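import Summits.BirchSwinnertonDyer.BirchSwinnertonDyer.Theorems.AlignedTransportAtTwoMainConjectureOfRankZeroBSDAtTwoCubicKilfordPrimes
import Summits.BirchSwinnertonDyer.BirchSwinnertonDyer.Theorems.AlignedTransportAtTwoMainConjectureOfRankZeroBSDAtTwoCubicTowerJumps
import HarnessLib

/-!
# Route `AlignedTransportAtTwo`, crux C2 `MainConjectureOfRankZeroBSDAtTwo` (stmt-BirchSwinnertonDyer-22298):
# THE KILFORD SEEDS' CUBIC TOWER JUMPS AT EVERY LAYER — UNCONDITIONALLY: att-p3 g25's Chevalley growth law and the death of the ORDER-form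
# layer door, with their displayed input «three places above `2` in `ℚ(β)`» DISCHARGED by this seat's dictionary (`Δ_min ≡ 1 (mod 8)`)

HONEST FRAMING (cell `bsd-f1-sign2`, WIDTH-5 attached prover seat `bsd-line-att-p5` gen 26 on line `birth` of the lead `bsd-line-att-p2`;
`--supports` stmt-BirchSwinnertonDyer-22298, closes nothing; BSD is NOT proved by any of this; the crux C2, its verdict «blocked-on
`Rank1Residual.GreenbergMuConjectureIrreducible`» and every registered stub are untouched). THEOREMS ONLY. Pure composition of two accepted files of
this hour — att-p3 g25's `…CubicTowerJumps` (p747920: for `W` with `Δ_W < 0`, `E_W(ℚ)[2] = 0`, THREE places above `2` in `ℚ(β)`: `e_0 + n ≤ e_n + 1` and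
`e_{n+1} ≠ e_n` at every layer of every cyclotomic `ℤ₂`-tower of `ℚ(β)`; hence the ORDER-form certificate of the layer doors is FALSE; `μ = 0 ⟹ λ ≥ 1`)
and this seat's `…CubicKilfordPrimes` (p746875: ON the Kilford stratum ⟹ three places above `2`). REF1 §263 R263a recorded the consequence: the ORDER-form
doors `…CubicLayerOneDoors.…_of_threePrimes_of_classNumberPExp_succ_eq` (g25) and `…CubicKilfordPrimes.…_of_onKilfordStratumAtTwo_of_classNumberPExp_succ_eq`
(g26) prove `MC₂` from an unsatisfiable hypothesis on the whole Kilford sub-cell — harmless, but NOT doors; only the `2`-RANK forms are. This file puts that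
fact in the kernel WITHOUT any displayed number-field bit. Nothing of att-p3's is re-derived; their theorems are consumed by name.

WHAT (`W/ℚ` globally minimal, good ORDINARY at `2`, no rational `2`-torsion abscissa, `Δ_W < 0`, ON the Kilford stratum — equivalently `Δ_min(W) ≡ 1 (mod 8)`;
`β ∈ ℚ̄` a root of `4x³ + b₂x² + 2b₄x + b₆`; `κP` any cyclotomic `ℤ₂`-extension of `ℚ(β)`):
* **`classNumberPExp_layer_growth_seedCubicField_of_onKilfordStratumAtTwo`**: `e_0(κP) + n ≤ e_n(κP) + 1` and `e_{n+1}(κP) ≠ e_n(κP)` for every `n`;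
  `le_classNumberPExp_succ_…` (`n ≤ e_{n+1}`: `#Cl(ℚ(e₁)_n)[2^∞]` unbounded).
* **`not_forall_exists_classNumberPExp_succ_eq_seedCubicField_of_onKilfordStratumAtTwo`** (and its `Δ_min % 8 = 1` form): the displayed certificate
  `hcert` of the ORDER-form doors is FALSE — those doors are dead on the whole Kilford sub-cell (⊇ all twelve certified seeds).
* **`one_le_slope_of_classicalMuVanishes_seedCubicField_of_onKilfordStratumAtTwo`**: if `μ(κP) = 0` then `e_n = λ n + ν` eventually with `λ ≥ 1`.

Nothing is asserted about any seed's class numbers beyond these inequalities; nothing is closed; BSD is not proved.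

References: [Lang1990] Ch. 13 §4, Lemma 4.1–4.2; [Washington1997] §13.1; [Fukuda1994] Thm. 1 (1)(2), p. 264; [NeukirchANT1999] Ch. II §8; tree: att-p3 g25
p747792 / p747920, att-p5 g25 p743166, g26 p746875; REF1-AUDIT §263.
-/

set_option linter.dupNamespace false
set_option autoImplicit false

noncomputable section

open scoped Classical NumberField nonZeroDivisors

namespace Summit.BirchSwinnertonDyer.BirchSwinnertonDyer.Theorems.AlignedTransportAtTwoCubicKilfordTowerGrowth

open NumberField IsDedekindDomain Polynomial WeierstrassCurve IntermediateField
  Literature.NumberTheory.IwasawaTheory Literature.NumberTheory.GaloisRepresentations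
  Literature.NumberTheory.EllipticCurves Literature.NumberTheory.EllipticCurves.Greenberg1999
  Summit.BirchSwinnertonDyer.Rank1Residual.F1Sign2
  Summit.BirchSwinnertonDyer.BirchSwinnertonDyer.Theorems.AlignedTransportAtTwoKilfordStratumShared
  Summit.BirchSwinnertonDyer.BirchSwinnertonDyer.Theorems.AlignedTransportAtTwoCubicLayerOneDoors
  Summit.BirchSwinnertonDyer.BirchSwinnertonDyer.Theorems.AlignedTransportAtTwoCubicKilfordPrimes
  Summit.BirchSwinnertonDyer.BirchSwinnertonDyer.Theorems.AlignedTransportAtTwoCubicTowerJumps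

variable (W : WeierstrassCurve ℚ) [W.IsElliptic] [W.IsGloballyMinimal]

/-- **THE CUBIC TOWER JUMPS AT EVERY LAYER, for every Kilford seed — no displayed bit.** `W/ℚ` globally minimal, good ORDINARY at `2`, no rational
`2`-torsion abscissa, `Δ_W < 0`, ON the Kilford stratum; `β ∈ ℚ̄` a root of the `2`-division cubic: for every cyclotomic `ℤ₂`-extension `κP` of
`ℚ(β)` and every `n`, `e_0(κP) + n ≤ e_n(κP) + 1` and `e_{n+1}(κP) ≠ e_n(κP)` (att-p3 g25 `classNumberPExp_layer_growth_seedCubicField` ∘ this seat's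
`three_le_ncard_adjoin_root_twoTorsionPolynomial_of_onKilfordStratumAtTwo`). [cite: Lang1990, Ch. 13 §4, Lemma 4.1–4.2] [cite: Fukuda1994, Thm. 1 (1), p. 264]
[cite: NeukirchANT1999, Ch. II §8, (8.1)–(8.3)] -/
theorem classNumberPExp_layer_growth_seedCubicField_of_onKilfordStratumAtTwo (hord : IsOrdinaryAt W 2)
    (ht : ∀ x : ℚ, ¬ HasRationalTwoTorsionX W x) (hΔ : W.Δ < 0) (hs : OnKilfordStratumAtTwo W)
    {β : AlgebraicClosure ℚ} (hβ : aeval β W.twoTorsionPolynomial.toPoly = 0)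
    (κP : ZpExtension ↥(IntermediateField.adjoin ℚ ({β} : Set (AlgebraicClosure ℚ))) 2) (hκP : κP.IsCyclotomic) (n : ℕ) :
    classNumberPExp κP 0 + n ≤ classNumberPExp κP n + 1 ∧ classNumberPExp κP (n + 1) ≠ classNumberPExp κP n :=
  classNumberPExp_layer_growth_seedCubicField W hΔ ht hβ
    (three_le_ncard_adjoin_root_twoTorsionPolynomial_of_onKilfordStratumAtTwo W hord ht hs hβ) κP hκP n

/-- **`#Cl(ℚ(e₁)_n)[2^∞]` IS UNBOUNDED for every Kilford seed**: `n ≤ e_{n+1}(κP)`. [cite: Lang1990, Ch. 13 §4, Lemma 4.1–4.2] [cite: Washington1997, §13.1] -/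
theorem le_classNumberPExp_succ_seedCubicField_of_onKilfordStratumAtTwo (hord : IsOrdinaryAt W 2)
    (ht : ∀ x : ℚ, ¬ HasRationalTwoTorsionX W x) (hΔ : W.Δ < 0) (hs : OnKilfordStratumAtTwo W)
    {β : AlgebraicClosure ℚ} (hβ : aeval β W.twoTorsionPolynomial.toPoly = 0)
    (κP : ZpExtension ↥(IntermediateField.adjoin ℚ ({β} : Set (AlgebraicClosure ℚ))) 2) (hκP : κP.IsCyclotomic) (n : ℕ) :
    n ≤ classNumberPExp κP (n + 1) := by
  have := (classNumberPExp_layer_growth_seedCubicField_of_onKilfordStratumAtTwo W hord ht hΔ hs hβ κP hκP (n + 1)).1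
  omega

/-- **THE ORDER-FORM LAYER DOOR IS DEAD ON THE WHOLE KILFORD SUB-CELL — kernel, no displayed bit.** Under the cell hypotheses + ON the stratum,
the certificate «for every cyclotomic `κP` of `ℚ(β)` SOME `n` with `e_{n+1}(κP) = e_n(κP)`» displayed by
`…CubicLayerOneDoors.mazurMainConjecture_two_of_muIneqRel_of_threePrimes_of_classNumberPExp_succ_eq` (g25) and by
`…CubicKilfordPrimes.mazurMainConjecture_two_of_muIneqRel_of_onKilfordStratumAtTwo_of_classNumberPExp_succ_eq` (g26) is FALSE; only the `2`-RANK doors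
(`…_of_classGroupPRank_succ_eq`) certify `μ₂(ℚ(β)^{cyc}) = 0` there (att-p3 g25 `not_forall_exists_classNumberPExp_succ_eq_seedCubicField` ∘ dictionary;
REF1 §263 R263a). [cite: Fukuda1994, Thm. 1 (1)(2), p. 264] [cite: Lang1990, Ch. 13 §4, Lemma 4.1–4.2] -/
theorem not_forall_exists_classNumberPExp_succ_eq_seedCubicField_of_onKilfordStratumAtTwo (hord : IsOrdinaryAt W 2)
    (ht : ∀ x : ℚ, ¬ HasRationalTwoTorsionX W x) (hΔ : W.Δ < 0) (hs : OnKilfordStratumAtTwo W)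
    {β : AlgebraicClosure ℚ} (hβ : aeval β W.twoTorsionPolynomial.toPoly = 0) :
    ¬ ∀ κP : ZpExtension ↥(IntermediateField.adjoin ℚ ({β} : Set (AlgebraicClosure ℚ))) 2, κP.IsCyclotomic →
      ∃ n : ℕ, classNumberPExp κP (n + 1) = classNumberPExp κP n :=
  not_forall_exists_classNumberPExp_succ_eq_seedCubicField W hΔ ht hβ
    (three_le_ncard_adjoin_root_twoTorsionPolynomial_of_onKilfordStratumAtTwo W hord ht hs hβ)

/-- The same with the decidable hypothesis `Δ_min(W) % 8 = 1` (all twelve certified seeds of the cell). [cite: Fukuda1994, Thm. 1 (1), p. 264]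
[cite: Serre1973, Ch. II §3.3 Thm. 4] -/
theorem not_forall_exists_classNumberPExp_succ_eq_seedCubicField_of_minimalDiscriminantInt_emod_eight (hord : IsOrdinaryAt W 2)
    (ht : ∀ x : ℚ, ¬ HasRationalTwoTorsionX W x) (hΔ : W.Δ < 0) (h8 : minimalDiscriminantInt W % 8 = 1)
    {β : AlgebraicClosure ℚ} (hβ : aeval β W.twoTorsionPolynomial.toPoly = 0) :
    ¬ ∀ κP : ZpExtension ↥(IntermediateField.adjoin ℚ ({β} : Set (AlgebraicClosure ℚ))) 2, κP.IsCyclotomic →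
      ∃ n : ℕ, classNumberPExp κP (n + 1) = classNumberPExp κP n :=
  not_forall_exists_classNumberPExp_succ_eq_seedCubicField_of_onKilfordStratumAtTwo W hord ht hΔ
    ((onKilfordStratumAtTwo_iff_minimalDiscriminantInt_emod_eight W hord).mpr h8) hβ

/-- **`μ = 0 ⟹ λ ≥ 1` on the Kilford sub-cell — no displayed bit.** If a cyclotomic `ℤ₂`-extension `κP` of `ℚ(β)` has Iwasawa's `μ = 0`, then
`e_n(κP) = λ n + ν` for `n ≫ 0` with `λ ≥ 1` (att-p3 g25 `one_le_slope_of_classicalMuVanishes_of_cubic` ∘ dictionary): the μ-certificate the RANK door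
asks for can only come with a POSITIVE `λ`. [cite: Iwasawa1973MuInvariants, Thm. 2] [cite: Fukuda1994, Thm. 1 (2), p. 264] [cite: Lang1990, Ch. 13 §4, Lemma 4.1–4.2] -/
theorem one_le_slope_of_classicalMuVanishes_seedCubicField_of_onKilfordStratumAtTwo (hord : IsOrdinaryAt W 2)
    (ht : ∀ x : ℚ, ¬ HasRationalTwoTorsionX W x) (hΔ : W.Δ < 0) (hs : OnKilfordStratumAtTwo W)
    {β : AlgebraicClosure ℚ} (hβ : aeval β W.twoTorsionPolynomial.toPoly = 0)
    (κP : ZpExtension ↥(IntermediateField.adjoin ℚ ({β} : Set (AlgebraicClosure ℚ))) 2) (hκP : κP.IsCyclotomic) (hμ : ClassicalMuVanishes κP) :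
    ∃ (l : ℕ) (ν : ℤ) (n₀ : ℕ), 1 ≤ l ∧ ∀ n, n₀ ≤ n → (classNumberPExp κP n : ℤ) = l * n + ν := by
  have hirr := AlignedTransportAtTwoSeed.irr_two_of_forall_not_hasRationalTwoTorsionX W ht
  have hβint : IsIntegral ℚ β := ((AlgebraicClosure.isAlgebraic ℚ).isAlgebraic β).isIntegral
  haveI : FiniteDimensional ℚ ↥(IntermediateField.adjoin ℚ ({β} : Set (AlgebraicClosure ℚ))) :=
    IntermediateField.adjoin.finiteDimensional hβint
  haveI : NumberField ↥(IntermediateField.adjoin ℚ ({β} : Set (AlgebraicClosure ℚ))) := NumberField.mk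
  have h3 : Module.finrank ℚ ↥(IntermediateField.adjoin ℚ ({β} : Set (AlgebraicClosure ℚ))) = 3 :=
    AddKatoTwo.finrank_adjoin_root_twoTorsionPolynomial_eq_three W hirr hβ
  have h1 := nrRealPlaces_adjoin_root_twoTorsionPolynomial_eq_one W hΔ hirr hβ
  exact one_le_slope_of_classicalMuVanishes_of_cubic _ h3 h1
    (three_le_ncard_adjoin_root_twoTorsionPolynomial_of_onKilfordStratumAtTwo W hord ht hs hβ) κP hκP hμ

end Summit.BirchSwinnertonDyer.BirchSwinnertonDyer.Theorems.AlignedTransportAtTwoCubicKilfordTowerGrowth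

end
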